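import Literature.Computability.AlgebraicComplexity.ConstantFreeCircuits
import HarnessLib

/-!
# Chains of substitutions: the dynamic-programming bound for `complexity`

Topic `Computability/AlgebraicComplexity`, namespace `Literature.Computability.AlgebraicComplexity`.
Everything PROVED; no named facts, no new definitions.

The tree's `complexity` (`ArithCircuit.lean`) is a single-output measure, and its cost calculus
(`L(f+g), L(fg) ≤ L(f)+L(g)+1`, the substitution bound `complexity_aeval_le` of `IMMInVPProofs.lean`)
prices FORMULAS; a dynamic programme that reuses earlier entries QUADRATICALLY (e.g. the interval
recursion `N[i..j] = Σ_k x_{ik} N[i+1..k-1] N[k+1..j]` of the noncrossing matching polynomial, route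
FifoMatching items `NCInVP` / `Av231InVP`) cannot be folded into one state polynomial as in
`ElementarySymmetricCircuit.lean`. This file proves the general sharing bound
(Bürgisser 2000, proof of Prop. 2.3 / Rem. 2.7, "straight-line programs compute all intermediate
results at no extra cost"):

**Theorem** (`complexity_chain_le`). Let `f : Fin T → k[X_τ]` and step polynomials
`F : Fin T → k[X_τ, Y_0, …, Y_{T-1}]` with `f t = F t (X, (f s)_{s<t}, 0, …)` (the later entries
substituted by `0`). Then `L(f t) ≤ Σ_s L(F s)` for every `t`.

Proof: one circuit is grown gate list by gate list (`ArithCircuit.substCircuit`,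
`ConstantFreeCircuits.lean`): at step `t` a minimal circuit for `F t` is appended with its `Y_s`-inputs
wired to stable (truncated) operands reading the earlier values (`eval_substCircuit`,
`Operand.eval_truncate_append`); the invariant is that every earlier value is read off the current
gate list by a stable operand, whatever is appended later (`gateValues_prefix`).

## References

* [Burgisser2000] P. Bürgisser, *Completeness and Reduction in Algebraic Complexity Theory*,
  Springer 2000, Def. 2.1, proof of Prop. 2.3, Rem. 2.7.
-/

noncomputable section

open MvPolynomial

namespace Literature.Computability.AlgebraicComplexity

universe u v

variable {k : Type u} [CommSemiring k] {τ : Type v}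

open ArithCircuit

/-- The value list of a gate list is a prefix of the value list of any extension of it.
[cite: Burgisser2000, Def. 2.1] -/
theorem ArithCircuit.gateValues_prefix (pre gs : List (Gate k τ)) :
    ∃ tl : List (MvPolynomial τ k), gateValues (pre ++ gs) = gateValues pre ++ tl := by
  induction gs using List.reverseRecOn with
  | nil => exact ⟨[], by simp⟩
  | append_singleton gs g ih =>
    obtain ⟨tl, htl⟩ := ih
    refine ⟨tl ++ [g.eval (gateValues (pre ++ gs))], ?_⟩
    rw [← List.append_assoc, gateValues_append_singleton, htl, List.append_assoc]

/-- **The dynamic-programming bound.** If `f t = F t (X, (f s)_{s < t}, 0, …)` for all `t < T`, then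
`L(f t) ≤ Σ_{s < T} L(F s)`: all entries of the table are computed by ONE fan-in-two circuit of that
size (Bürgisser 2000, proof of Prop. 2.3 / Rem. 2.7). [cite: Burgisser2000, Rem. 2.7] -/
theorem complexity_chain_le {T : ℕ} (f : Fin T → MvPolynomial τ k)
    (F : Fin T → MvPolynomial (τ ⊕ Fin T) k)
    (hF : ∀ t : Fin T, f t = aeval (Sum.elim X (fun s : Fin T => if s < t then f s else 0)) (F t))
    (t : Fin T) : complexity (f t) ≤ ∑ s : Fin T, complexity (F s) := by
  classical
  -- cost of step `s`, as a function on `ℕ`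
  let c : ℕ → ℕ := fun s => if h : s < T then complexity (F ⟨s, h⟩) else 0
  -- invariant after `m` steps: a fan-in-two gate list of length `Σ_{s<m} c s` off which stable operands
  -- read `f s` for every `s < m`
  have key : ∀ m : ℕ, m ≤ T → ∃ (G : List (Gate k τ)) (o : Fin T → Operand k τ),
      (∀ g ∈ G, g.fanIn ≤ 2) ∧ G.length = ∑ s ∈ Finset.range m, c s ∧
      ∀ s : Fin T, (s : ℕ) < m → ∀ ws, (o s).eval (gateValues G ++ ws) = f s := by
    intro m
    induction m with
    | zero =>
      intro _
      exact ⟨[], fun _ => Operand.const 0, fun g hg => by simp at hg, by simp,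
        fun s hs => absurd hs (Nat.not_lt_zero _)⟩
    | succ m ih =>
      intro hm
      obtain ⟨G, o, hfan, hlen, hval⟩ := ih (Nat.le_of_succ_le hm)
      have hmT : m < T := hm
      set tm : Fin T := ⟨m, hmT⟩ with htm
      obtain ⟨P, hP2, hPc, hPs⟩ := exists_computes_size_eq_complexity (F tm)
      -- wiring of the inputs of `P`
      let ρ : τ ⊕ Fin T → Operand k τ :=
        Sum.elim Operand.var (fun s => if (s : ℕ) < m then o s else Operand.const 0)
      let h : τ ⊕ Fin T → MvPolynomial τ k :=
        Sum.elim X (fun s : Fin T => if s < tm then f s else 0)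
      have hρ : ∀ i ws, (ρ i).eval (gateValues G ++ ws) = h i := by
        rintro (x | s) ws
        · rfl
        · change (if (s : ℕ) < m then o s else Operand.const 0).eval (gateValues G ++ ws) =
            if s < tm then f s else 0
          have hiff : s < tm ↔ (s : ℕ) < m := Fin.lt_def
          by_cases hs : (s : ℕ) < m
          · rw [if_pos hs, if_pos (hiff.2 hs), hval s hs]
          · rw [if_neg hs, if_neg (fun h' => hs (hiff.1 h'))]
            exact C_0
      let Q : ArithCircuit k τ := P.substCircuit G ρ
      have hQeval : Q.eval = f tm := by
        rw [eval_substCircuit P G hρ, hPc, hF tm]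
      have hQfan : Q.IsFanInTwo := IsFanInTwo.substCircuit hP2 hfan ρ
      obtain ⟨tl, htl⟩ := ArithCircuit.gateValues_prefix (k := k) G (P.gates.map (Gate.subst ρ G.length))
      refine ⟨Q.gates, fun s => if (s : ℕ) < m then o s else Q.output.truncate (gateValues Q.gates).length,
        hQfan, ?_, ?_⟩
      · -- length bookkeeping
        change (G ++ P.gates.map (Gate.subst ρ G.length)).length = _
        rw [List.length_append, List.length_map, hlen, Finset.sum_range_succ]
        change _ + P.size = _
        rw [hPs]
        simp only [c, dif_pos hmT]
        rfl
      · intro s hs ws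
        dsimp only
        by_cases hsm : (s : ℕ) < m
        · -- an earlier value: the old operand still reads it off the longer list
          rw [if_pos hsm]
          change (o s).eval (gateValues (G ++ P.gates.map (Gate.subst ρ G.length)) ++ ws) = f s
          rw [htl, List.append_assoc]
          exact hval s hsm _
        · -- the new value
          have hseq : s = tm := Fin.ext (by
            have := Nat.lt_succ_iff.1 hs
            change (s : ℕ) = m
            omega)
          rw [if_neg hsm, Operand.eval_truncate_append, hseq]
          exact hQeval
  obtain ⟨G, o, hfan, hlen, hval⟩ := key T le_rfl
  -- the circuit `⟨G, o t⟩` computes `f t`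
  have hcomp : (⟨G, o t⟩ : ArithCircuit k τ).Computes (f t) := by
    change (o t).eval (gateValues G) = f t
    have := hval t t.isLt []
    rwa [List.append_nil] at this
  refine (complexity_le_size (P := ⟨G, o t⟩) (fun g hg => hfan g hg) hcomp).trans ?_
  change G.length ≤ _
  rw [hlen, Finset.sum_range]
  refine le_of_eq (Finset.sum_congr rfl fun s _ => ?_)
  simp only [c, dif_pos s.isLt]

end Literature.Computability.AlgebraicComplexity

end
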